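import Summits.PneNP.PneNP.Theorems.ConvexRankGatesCliqueExtLowerBoundWidthThresholdNarrow
import Summits.PneNP.PneNP.Theorems.ResolutionUncertainty.Negative.BadCliques
import Mathlib

/-!
# Wide CYCLIC permutation gates are sandwichable (partial result for the stub
`stub_permSandwichable`, line `width-threshold-certificate-sparsity`, crux
`ConvexRankGates.CliqueExtLowerBound`, stmt-PneNP-10682, route PneNP/ConvexRankGates)

The open stub `stub_permSandwichable` asks that every WIDE PERM gate (`φ(v) = 1` iff
`τ ∈ ⟨σᵢ : vᵢ = 1⟩`, permutations of `≤ m^c` points) fed with local child pairs be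
`(r,s)`-sandwichable on the referee pair. The landed `perm_smallGroup_sandwichable` settles the
gates whose generators generate a group of SMALL ORDER (`< 2^{L+1}`). Here we settle a sub-class
of a different nature, with no bound on the order of the group at all:

* `perm_cyclic_sandwichable` (REGISTERED): if all `σᵢ` lie in ONE cyclic group `⟨g⟩` (e.g. all
  `σᵢ` are powers of a single permutation, whose order may be `e^{Ω(√(d log d))}`, far beyond the
  small-group threshold), then `φ` fed with `≤ m^{c+3}` distinct local child pairs is sandwichable
  with error `1/(8 m^{c+1})`, for `r ≥ r₀(c)`, `s ≥ s₀(c)` and all large `m`.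

Proof. PRIME BY PRIME (`mem_closure_iff_primeFactors`): inside a finite cyclic group the subgroup
of each order is unique, so `τ ∈ ⟨σᵢ : i ∈ S⟩` iff for every prime `p ∣ ord τ` some `σᵢ`, `i ∈ S`,
has order divisible by `p^{v_p(ord τ)}` — an AND over `≤ d + 1` primes of ORs of wires. On the
push-forwards two wires with the same child pair carry the same value, so each OR is restricted to
one representative wire per distinct child pair (`exists_reps`): a `{∧₂,∨₂,0,1}`-circuit with
`≤ m^{2c+4}` gates agreeing with `φ` on both push-forwards (`perm_cyclic_replaceable`, `Replaceable`
with error `0`); the landed `inline_statement (2c+4) c` turns it into a sandwich. So the PERM residue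
of the line is NON-CYCLIC (abelian of rank `≥ 2` = monotone span programs, `…PermCalibration`).
-/

set_option linter.dupNamespace false

open Literature.Computability.Complexity Filter Finset

noncomputable section

namespace Summit.PneNP.PneNP.Theorems.CliqueExtLowerBound.WidthThreshold.PermPartial

open Summit.PneNP.PneNP.Theorems.ResolutionUncertainty.Negative (cktSize_listOr cktSize_listAnd)

/-! ## §1 Subgroups of a finite cyclic group, prime by prime -/

/-- In a finite cyclic group, an element whose order divides the order of a subgroup lies in
that subgroup (the subgroup of each order is unique: `H` is the kernel of `x ↦ x^{|H|}`, which has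
`gcd(|K|, |H|) = |H|` elements). [folklore] -/
theorem mem_of_orderOf_dvd_card {K : Type*} [Group K] [IsCyclic K] [Finite K] (H : Subgroup K)
    {x : K} (hx : orderOf x ∣ Nat.card H) : x ∈ H := by
  letI : CommGroup K := IsCyclic.commGroup
  have hker : H = (powMonoidHom (Nat.card H) : K →* K).ker := by
    refine Subgroup.eq_of_le_of_card_ge (fun h hh => ?_) ?_
    · rw [MonoidHom.mem_ker, powMonoidHom_apply]
      exact orderOf_dvd_iff_pow_eq_one.1 (H.orderOf_dvd_natCard hh)
    · rw [IsCyclic.card_powMonoidHom_ker]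
      exact Nat.le_of_dvd Nat.card_pos (Nat.gcd_dvd_right _ _)
  rw [hker, MonoidHom.mem_ker, powMonoidHom_apply]
  exact orderOf_dvd_iff_pow_eq_one.1 hx

/-- **Membership in the subgroup generated by elements of a cyclic group, prime by prime.** In a
finite group, if `T` and `τ` lie in the cyclic subgroup `⟨g⟩`, then `τ ∈ ⟨T⟩` iff for every prime
`p` dividing the order of `τ`, some `t ∈ T` has order divisible by the full power
`p ^ v_p(ord τ)`. (⇒: the order of a product of commuting elements divides the lcm of the orders;
⇐: inside `⟨g⟩` the order of `τ` divides `|⟨T⟩|`, and `mem_of_orderOf_dvd_card`.) [folklore] -/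
theorem mem_closure_iff_primeFactors {G : Type*} [Group G] [Finite G] {g τ : G} {T : Set G}
    (hT : T ⊆ Subgroup.zpowers g) (hτ : τ ∈ Subgroup.zpowers g) :
    τ ∈ Subgroup.closure T ↔ ∀ p ∈ (orderOf τ).primeFactors, ∃ t ∈ T,
      p ^ (orderOf τ).factorization p ∣ orderOf t := by
  constructor
  · intro hmem
    suffices key : τ ∈ Subgroup.zpowers g ∧ ∀ p ∈ (orderOf τ).primeFactors, ∃ t ∈ T,
        p ^ (orderOf τ).factorization p ∣ orderOf t from key.2
    clear hτ
    induction hmem using Subgroup.closure_induction with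
    | mem x hx => exact ⟨hT hx, fun p _ => ⟨x, hx, Nat.ordProj_dvd _ _⟩⟩
    | one => exact ⟨one_mem _, fun p hp => by simp at hp⟩
    | inv x _ ih => exact ⟨inv_mem ih.1, by rw [orderOf_inv]; exact ih.2⟩
    | mul x y _ _ ihx ihy =>
      refine ⟨mul_mem ihx.1 ihy.1, fun p hp => ?_⟩
      obtain ⟨a, rfl⟩ := Subgroup.mem_zpowers_iff.1 ihx.1
      obtain ⟨b, rfl⟩ := Subgroup.mem_zpowers_iff.1 ihy.1
      have hcomm : Commute (g ^ a) (g ^ b) := (Commute.refl g).zpow_zpow a b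
      have hp' := Nat.prime_of_mem_primeFactors hp
      have hx0 : orderOf (g ^ a) ≠ 0 := (orderOf_pos _).ne'
      have hy0 : orderOf (g ^ b) ≠ 0 := (orderOf_pos _).ne'
      have hdvd : p ^ (orderOf (g ^ a * g ^ b)).factorization p ∣
          Nat.lcm (orderOf (g ^ a)) (orderOf (g ^ b)) :=
        (Nat.ordProj_dvd _ _).trans hcomm.orderOf_mul_dvd_lcm
      rw [hp'.pow_dvd_iff_le_factorization (Nat.lcm_ne_zero hx0 hy0),
        Nat.factorization_lcm hx0 hy0, Finsupp.sup_apply, le_sup_iff] at hdvd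
      have hpos : 0 < (orderOf (g ^ a * g ^ b)).factorization p :=
        Nat.Prime.factorization_pos_of_dvd hp' (orderOf_pos _).ne' (Nat.dvd_of_mem_primeFactors hp)
      rcases hdvd with h | h
      · have hpa : p ∈ (orderOf (g ^ a)).primeFactors := by
          rw [← Nat.support_factorization, Finsupp.mem_support_iff]
          omega
        obtain ⟨t, ht, hdt⟩ := ihx.2 p hpa
        exact ⟨t, ht, (pow_dvd_pow p h).trans hdt⟩
      · have hpb : p ∈ (orderOf (g ^ b)).primeFactors := by
          rw [← Nat.support_factorization, Finsupp.mem_support_iff]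
          omega
        obtain ⟨t, ht, hdt⟩ := ihy.2 p hpb
        exact ⟨t, ht, (pow_dvd_pow p h).trans hdt⟩
  · intro h
    set K := Subgroup.zpowers g with hK
    set H : Subgroup K := (Subgroup.closure T).subgroupOf K with hH
    have hdvd : orderOf (⟨τ, hτ⟩ : K) ∣ Nat.card H := by
      rw [Subgroup.orderOf_mk]
      have hc0 : Nat.card H ≠ 0 := Nat.card_pos.ne'
      rw [← Nat.factorization_le_iff_dvd (orderOf_pos τ).ne' hc0]
      intro p
      by_cases hp : p ∈ (orderOf τ).primeFactors
      · obtain ⟨t, ht, hpt⟩ := h p hp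
        have htH : (⟨t, hT ht⟩ : K) ∈ H := Subgroup.mem_subgroupOf.2 (Subgroup.subset_closure ht)
        have h2 : orderOf t ∣ Nat.card H := by
          have := H.orderOf_dvd_natCard htH
          rwa [Subgroup.orderOf_mk] at this
        exact (Nat.prime_of_mem_primeFactors hp).pow_dvd_iff_le_factorization hc0 |>.1
          (hpt.trans h2)
      · rw [← Nat.support_factorization, Finsupp.notMem_support_iff] at hp
        rw [hp]
        exact Nat.zero_le _
    exact Subgroup.mem_subgroupOf.1 (mem_of_orderOf_dvd_card H hdvd)

/-- The primes dividing the order of a permutation of `d` points are at most `d` (they divide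
`d!`), so there are at most `d + 1` of them. [folklore] -/
theorem card_primeFactors_orderOf_perm_le {d : ℕ} (τ : Equiv.Perm (Fin d)) :
    #(orderOf τ).primeFactors ≤ d + 1 := by
  calc #(orderOf τ).primeFactors ≤ #(Finset.range (d + 1)) := by
        refine Finset.card_le_card fun p hp => Finset.mem_range.2 (Nat.lt_succ_of_le ?_)
        have hp' := Nat.prime_of_mem_primeFactors hp
        have h1 : p ∣ Nat.factorial d := by
          have := (Nat.dvd_of_mem_primeFactors hp).trans (orderOf_dvd_card (x := τ))
          rwa [Fintype.card_perm, Fintype.card_fin] at this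
        exact hp'.dvd_factorial.1 h1
    _ = d + 1 := Finset.card_range _

/-! ## §2 Representatives of the child classes and the gate on class-constant inputs -/

/-- **One representative per class.** For a finite set `s` of wires and a labelling `key`, there is
`R ⊆ s` with at most `#(image key)` elements meeting every `key`-class of `s` (the least wire of
each class). [folklore] -/
theorem exists_reps {n : ℕ} {α : Type*} [DecidableEq α] (s : Finset (Fin n)) (key : Fin n → α) :
    ∃ R : Finset (Fin n), R ⊆ s ∧ #R ≤ #(univ.image key) ∧ ∀ i ∈ s, ∃ j ∈ R, key j = key i := by
  refine ⟨s.filter fun i => ∀ i' ∈ s, key i' = key i → i ≤ i', Finset.filter_subset _ _, ?_, ?_⟩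
  · refine Finset.card_le_card_of_injOn key
      (fun i _ => Finset.mem_coe.2 (Finset.mem_image_of_mem key (Finset.mem_univ i))) ?_
    intro a ha b hb hab
    rw [Finset.coe_filter] at ha hb
    exact le_antisymm (ha.2 b hb.1 hab.symm) (hb.2 a ha.1 hab)
  · intro i hi
    have hne : (s.filter fun i' => key i' = key i).Nonempty := ⟨i, by simp [hi]⟩
    set j := (s.filter fun i' => key i' = key i).min' hne with hj
    have hjmem : j ∈ s.filter fun i' => key i' = key i := Finset.min'_mem _ hne
    rw [Finset.mem_filter] at hjmem
    refine ⟨j, Finset.mem_filter.2 ⟨hjmem.1, fun i' hi' hkey => ?_⟩, hjmem.2⟩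
    exact Finset.min'_le _ _ (Finset.mem_filter.2 ⟨hi', hkey.trans hjmem.2⟩)

/-- **The cyclic gate on class-constant inputs is an AND of ORs over representatives.** With all
`σᵢ` and `τ` in `⟨g⟩`, an input `v` constant on the `key`-classes, and representative sets `R p`
inside the clauses `{i : p^{v_p(ord τ)} ∣ ord σᵢ}` meeting every class of them:
`τ ∈ ⟨σᵢ : vᵢ = 1⟩` iff for every prime `p ∣ ord τ` some representative `i ∈ R p` is on. [folklore] -/
theorem mem_closure_iff_reps {n d : ℕ} {σ : Fin n → Equiv.Perm (Fin d)} {τ g : Equiv.Perm (Fin d)}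
    (hσ : ∀ i, σ i ∈ Subgroup.zpowers g) (hτ : τ ∈ Subgroup.zpowers g) {α : Type*}
    (key : Fin n → α) {v : Fin n → Bool} (hv : ∀ i i', key i = key i' → v i = v i')
    (R : ℕ → Finset (Fin n))
    (hR₁ : ∀ p, ∀ i ∈ R p, p ^ (orderOf τ).factorization p ∣ orderOf (σ i))
    (hR₂ : ∀ p (i : Fin n), p ^ (orderOf τ).factorization p ∣ orderOf (σ i) →
      ∃ j ∈ R p, key j = key i) :
    τ ∈ Subgroup.closure (σ '' {i | v i = true}) ↔
      ∀ p ∈ (orderOf τ).primeFactors, ∃ i ∈ R p, v i = true := by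
  have hT : σ '' {i | v i = true} ⊆ Subgroup.zpowers g := by
    rintro _ ⟨i, -, rfl⟩
    exact hσ i
  rw [mem_closure_iff_primeFactors hT hτ]
  refine forall₂_congr fun p _ => ⟨?_, ?_⟩
  · rintro ⟨_, ⟨i, hi, rfl⟩, hdvd⟩
    obtain ⟨j, hj, hkey⟩ := hR₂ p i hdvd
    exact ⟨j, hj, (hv j i hkey).trans hi⟩
  · rintro ⟨i, hi, hvi⟩
    exact ⟨σ i, ⟨i, hvi, rfl⟩, hR₁ p i hi⟩

/-! ## §3 An AND of ORs as a small `{∧₂, ∨₂, 0, 1}`-circuit -/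

/-- **An AND of ORs.** For a finite set `Q` of clauses and wire sets `R q`, the function
`v ↦ ⋀_{q ∈ Q} ⋁_{i ∈ R q} vᵢ` has a `{∧₂, ∨₂, 0, 1}`-circuit with
`∑_{q ∈ Q} (#R q + 1) + #Q + 1` gates (the tree's `cktSize_listOr` per clause, bundled by
`CktSize.pi`, followed by `cktSize_listAnd`). [folklore] -/
theorem cktSize_andOr {ι β : Type} (Q : Finset β) (R : β → Finset ι) :
    ∃ f : (ι → Bool) → Unit → Bool,
      CktSize monotoneBasis01 f (∑ q ∈ Q, (#(R q) + 1) + (#Q + 1)) ∧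
      ∀ v, f v () = true ↔ ∀ q ∈ Q, ∃ i ∈ R q, v i = true := by
  classical
  have h1 : CktSize monotoneBasis01 (fun (v : ι → Bool) (q : ↥Q) => (R q).toList.any v)
      (∑ q : ↥Q, (#(R q) + 1)) := by
    refine CktSize.pi fun q => ?_
    have := cktSize_listOr (ι := ι) (R q).toList
    rwa [Finset.length_toList] at this
  have h2 : CktSize monotoneBasis01
      (fun (y : ↥Q → Bool) (_ : Unit) => (univ : Finset ↥Q).toList.all y) (#Q + 1) := by
    have := cktSize_listAnd (ι := ↥Q) (univ : Finset ↥Q).toList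
    rwa [Finset.length_toList, Finset.card_univ, Fintype.card_coe] at this
  have h3 := h1.comp h2
  rw [Finset.sum_coe_sort Q (fun q => #(R q) + 1)] at h3
  refine ⟨_, h3, fun v => ?_⟩
  show ((univ : Finset ↥Q).toList.all fun q => (R q).toList.any v) = true ↔ _
  rw [List.all_eq_true]
  simp only [Finset.mem_toList, Finset.mem_univ, true_implies, List.any_eq_true,
    Subtype.forall]


/-! ## §4 Cyclic PERM gates are replaceable with error `0` -/

/-- Size bookkeeping: `(m^c + 1)(m^{c+3} + 2) + 1 ≤ m^{2c+4}` for `m ≥ 7`. [folklore] -/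
theorem size_bound {m c : ℕ} (hm : 7 ≤ m) :
    (m ^ c + 1) * (m ^ (c + 3) + 2) + 1 ≤ m ^ (2 * c + 4) := by
  have hX : 1 ≤ m ^ c := Nat.one_le_pow _ _ (by omega)
  have hY : 1 ≤ m ^ (c + 3) := Nat.one_le_pow _ _ (by omega)
  have hXY : m ^ (2 * c + 4) = m * (m ^ c * m ^ (c + 3)) := by
    rw [show 2 * c + 4 = 1 + (c + (c + 3)) by ring, pow_add, pow_add, pow_one]
  rw [hXY]
  have h1 : (m ^ c + 1) * (m ^ (c + 3) + 2) + 1 ≤ 7 * (m ^ c * m ^ (c + 3)) := by nlinarith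
  exact h1.trans (Nat.mul_le_mul_right _ hm)

open Classical in
/-- **A wide cyclic PERM gate is REPLACEABLE with error `0`** by monotone complexity `m^{2c+4}`:
for children with `≤ m^{c+3}` distinct pairs there is a `{∧₂,∨₂,0,1}`-circuit on the gate's inputs
agreeing with the gate on every class-constant input, in particular on both push-forwards (if
`τ ∉ ⟨g⟩` the gate is constantly `0`; otherwise the AND over the primes `p ∣ ord τ` of the ORs of
one representative wire per child class inside `{i : p^{v_p(ord τ)} ∣ ord σᵢ}`). [folklore] -/
theorem perm_cyclic_replaceable {m c r s : ℕ} (hm : 7 ≤ m) {φ : GateFn} {d : ℕ}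
    {σ : Fin φ.1 → Equiv.Perm (Fin d)} {τ g : Equiv.Perm (Fin d)}
    (hφ : ∀ v : Fin φ.1 → Bool, φ.2 v = true ↔ τ ∈ Subgroup.closure (σ '' {i | v i = true}))
    (hd : d ≤ m ^ c) (hσ : ∀ i, σ i ∈ Subgroup.zpowers g) :
    Replaceable r s (m ^ (c + 3)) (m ^ (2 * c + 4)) (posFam m) (negFam m) 0 φ := by
  intro D C hA _ _ _
  -- a circuit agreeing with `φ` on every input constant on the child classes suffices
  suffices hΨ : ∃ Ψ : Circuit (Fin φ.1), Ψ.IsOver monotoneBasis01 ∧ Ψ.size ≤ m ^ (2 * c + 4) ∧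
      ∀ v : Fin φ.1 → Bool, (∀ i i', (D i, C i) = (D i', C i') → v i = v i') → Ψ.eval v = φ.2 v by
    obtain ⟨Ψ, hΨB, hΨs, hΨe⟩ := hΨ
    have hdv : ∀ x : EV m → Bool, Ψ.eval (dval D x) = φ.2 (dval D x) := fun x =>
      hΨe _ fun i i' h => by simp only [dval, (Prod.mk.inj h).1]
    have hcv : ∀ x : EV m → Bool, Ψ.eval (cval C x) = φ.2 (cval C x) := fun x =>
      hΨe _ fun i i' h => by simp only [cval, (Prod.mk.inj h).2]
    refine ⟨Ψ, hΨB, hΨs, ?_, ?_⟩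
    · rw [Finset.filter_eq_empty_iff.2 fun x _ h => ?_, card_empty, Nat.cast_zero, zero_mul]
      rw [hdv x] at h
      exact Bool.false_ne_true (h.2.symm.trans h.1)
    · rw [Finset.filter_eq_empty_iff.2 fun x _ h => ?_, card_empty, Nat.cast_zero, zero_mul]
      rw [hcv x] at h
      exact Bool.false_ne_true (h.2.symm.trans h.1)
  have h1m : 1 ≤ m ^ (2 * c + 4) := Nat.one_le_pow _ _ (by omega)
  by_cases hτ : τ ∈ Subgroup.zpowers g
  · -- the AND over the primes `p ∣ ord τ` of the ORs over representatives
    set key : Fin φ.1 → Finset (Finset (EV m)) × Finset (Finset (EV m)) := fun j => (D j, C j)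
      with hkey
    choose R hRsub hRcard hRrep using fun p : ℕ => exists_reps
      (univ.filter fun i : Fin φ.1 => p ^ (orderOf τ).factorization p ∣ orderOf (σ i)) key
    obtain ⟨f, hf, hfv⟩ := cktSize_andOr (ι := Fin φ.1) (orderOf τ).primeFactors R
    obtain ⟨Ψ, hΨB, hΨs, hΨe⟩ := hf.toCircuit
    refine ⟨Ψ, hΨB, hΨs.trans ?_, fun v hv => ?_⟩
    · -- size
      have hq : #(orderOf τ).primeFactors ≤ m ^ c + 1 :=
        (card_primeFactors_orderOf_perm_le τ).trans (by omega)
      calc ∑ q ∈ (orderOf τ).primeFactors, (#(R q) + 1) + (#(orderOf τ).primeFactors + 1)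
          ≤ ∑ _q ∈ (orderOf τ).primeFactors, (m ^ (c + 3) + 1) +
              (#(orderOf τ).primeFactors + 1) := by
            gcongr with q _
            exact (hRcard q).trans hA
        _ = #(orderOf τ).primeFactors * (m ^ (c + 3) + 2) + 1 := by
            rw [Finset.sum_const, smul_eq_mul]; ring
        _ ≤ (m ^ c + 1) * (m ^ (c + 3) + 2) + 1 := by gcongr
        _ ≤ m ^ (2 * c + 4) := size_bound hm
    · -- agreement on class-constant inputs
      rw [hΨe v, Bool.eq_iff_iff, hfv v, hφ v]
      refine (mem_closure_iff_reps hσ hτ key hv R (fun p i hi => ?_) (fun p i hi => ?_)).symm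
      · have := hRsub p hi
        rw [Finset.mem_filter] at this
        exact this.2
      · exact hRrep p i (Finset.mem_filter.2 ⟨Finset.mem_univ _, hi⟩)
  · -- `τ ∉ ⟨g⟩`: the gate is constantly `0`
    obtain ⟨Ψ, hΨB, hΨs, hΨe⟩ := (cktSize_const_mono01 (Fin φ.1) false).toCircuit
    refine ⟨Ψ, hΨB, hΨs.trans h1m, fun v _ => ?_⟩
    rw [hΨe v]
    symm
    rw [← Bool.not_eq_true, hφ v]
    refine fun h => hτ ((Subgroup.closure_le _).2 ?_ h)
    rintro _ ⟨i, -, rfl⟩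
    exact hσ i

/-! ## §5 The registered statement -/

open Classical in
/-- REGISTERED SUB-GOAL of the line, partial result for `stub_permSandwichable`. **Wide CYCLIC
permutation gates are sandwichable.** For every `c` there are `r₀, s₀` such that for `r ≥ r₀`,
`s ≥ s₀` and all large `m`: if `φ` accepts `v` iff `τ ∈ ⟨σᵢ : vᵢ = 1⟩` with permutations of
`d ≤ m^c` points ALL LYING IN ONE CYCLIC GROUP `⟨g⟩` (any order), then `φ` fed with `(r-1)`-DNFs
`D j` below `(s-1)`-CNFs `C j` with at most `m^{c+3}` distinct pairs satisfies the conclusion of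
`stub_permSandwichable` (error `1/(8 m^{c+1})` on both sides of the referee pair): the gate is
replaceable with error `0` by a `{∧₂,∨₂,0,1}`-circuit of size `≤ m^{2c+4}`
(`perm_cyclic_replaceable`) at which inline expansion is free (`inline_statement`). [folklore] -/
theorem perm_cyclic_sandwichable : ∀ c : ℕ, ∃ r₀ s₀ : ℕ, 2 ≤ r₀ ∧ 2 ≤ s₀ ∧
    ∀ r s : ℕ, r₀ ≤ r → s₀ ≤ s →
    ∀ᶠ m : ℕ in atTop, ∀ (φ : GateFn) (d : ℕ) (σ : Fin φ.1 → Equiv.Perm (Fin d))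
      (τ g : Equiv.Perm (Fin d)),
      (∀ v : Fin φ.1 → Bool, φ.2 v = true ↔ τ ∈ Subgroup.closure (σ '' {i | v i = true})) →
      d ≤ m ^ c → (∀ i, σ i ∈ Subgroup.zpowers g) →
      ∀ (D C : Fin φ.1 → Finset (Finset ((⊤ : SimpleGraph (Fin m)).edgeSet))),
        #(univ.image fun j => (D j, C j)) ≤ m ^ (c + 3) →
        (∀ j, ∀ R ∈ D j, #R ≤ r - 1) → (∀ j, ∀ S ∈ C j, #S ≤ s - 1) →
        (∀ j x, EvalDNF (D j) x → EvalCNF (C j) x) →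
        ∃ dnf cnf : Finset (Finset ((⊤ : SimpleGraph (Fin m)).edgeSet)),
          (∀ R ∈ dnf, #R ≤ r - 1) ∧ (∀ S ∈ cnf, #S ≤ s - 1) ∧
          (∀ x, EvalDNF dnf x → EvalCNF cnf x) ∧
          (#((posGraphs m ⌈(m : ℝ) ^ (1 / 4 : ℝ)⌉₊).filter
              (fun x => φ.2 (fun j => decide (EvalDNF (D j) x)) = true ∧ ¬ EvalDNF dnf x)) : ℝ)
            ≤ (1 / (8 * (m : ℝ) ^ (c + 1))) * #(posGraphs m ⌈(m : ℝ) ^ (1 / 4 : ℝ)⌉₊) ∧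
          (#((((powersetCard (Fintype.card ((⊤ : SimpleGraph (Fin m)).edgeSet) /
            ⌊(m : ℝ) ^ (1 / 8 : ℝ)⌋₊)
          (univ : Finset ((⊤ : SimpleGraph (Fin m)).edgeSet))).image
            (fun M => fun e => decide (e ∉ M)))).filter
              (fun x => EvalCNF cnf x ∧ φ.2 (fun j => decide (EvalCNF (C j) x)) = false)) : ℝ)
            ≤ (1 / (8 * (m : ℝ) ^ (c + 1))) *
              #(((powersetCard (Fintype.card ((⊤ : SimpleGraph (Fin m)).edgeSet) /
                ⌊(m : ℝ) ^ (1 / 8 : ℝ)⌋₊)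
          (univ : Finset ((⊤ : SimpleGraph (Fin m)).edgeSet))).image
            (fun M => fun e => decide (e ∉ M)))) := by
  intro c
  obtain ⟨r₀, s₀, hr₀, hs₀, hI⟩ := inline_statement (2 * c + 4) c
  refine ⟨r₀, s₀, hr₀, hs₀, fun r s hr hs => ?_⟩
  filter_upwards [hI r s hr hs, eventually_ge_atTop 7] with m hIm hm
  intro φ d σ τ g hφ hd hσ
  have hS := sandwichable_of_replaceable (perm_cyclic_replaceable (r := r) (s := s) hm hφ hd hσ) hIm
  rw [zero_add] at hS
  exact hS

end Summit.PneNP.PneNP.Theorems.CliqueExtLowerBound.WidthThreshold.PermPartial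

end
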